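import Literature.NumberTheory.LFunctions.AriasDeReynaKeiperLiCoefficients
import Literature.NumberTheory.LFunctions.Voros2006OesterleProofs
import HarnessLib

/-!
# Arias de Reyna 2011, Theorem 3.1 / Corollary 3.1: the Keiper–Li remainder is square-summable — proofs

LINE 1 — LABEL: **RH-FREE** real analysis (Theorem 3.1: an `ℓ²` law for Li-type sums over ANY point
configuration `½ ± iτ_k` on the line `Re s = ½` whose counting function has the Riemann–von Mangoldt shape)
plus ONE **RH-CONSEQUENCE** discharged with its explicit `RiemannHypothesis →` binder (Corollary 3.1, the
named fact `AriasDeReyna2011_cor31` of `AriasDeReynaKeiperLiCoefficients.lean`).  Cell rh-crit C2/dbl, row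
«dbl:R16-AdR11-cor31»; bears_on: L-C/L-P (LADDER-RH COLUMN 4, Li).  WHAT THIS IS NOT: a printed consequence of
RH formalised as such moves RH by nothing; the RH-EQUIVALENT criteria of the paper (Thm 4.3, main theorem)
become hypothesis-free EQUIVALENCES here — an equivalence is not a proof of either side.  Nothing in this file
bears on the truth of RH.

Source: J. Arias de Reyna, *Asymptotics of Keiper–Li coefficients*, Funct. Approx. Comment. Math. **45**
(2011) 7–21, doi:10.7169/facm/1317045228 (held text `paper:reyna2011-asymptotics-keiper-li-coefficients`),
Theorem 3.1 pp. 9–11 and Corollary 3.1 p. 11 [AriasDeReyna2011KeiperLi].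

## The printed proof (Thm 3.1, pp. 10–11) and how it is followed here

Printed: `J(m) := (4/m) Σ_j sin²(m θ_j) = (4/m) ∫₀^∞ sin²(m arctan(1/2t)) dN(t)`, `dN = (2π)⁻¹ log(t/2π) dt
+ dS(t)`, so `J = J₁ + J₂`; `J₁(m) = ½ log m − ½(log 2π + 1 − γ) + O(log m/m)` through the substitution
`y = arctan(1/2t)` and the two classical integrals `∫₀^∞ sin²x/x² dx = π/2`, `∫₀^∞ (sin²x/x²) log x dx =
π(1 − γ − log 2)/2`; `J₂(m) = 4 ∫₀^{π/2} sin(2my) S(1/(2 tan y)) dy` after a summation by parts, and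
«`S(1/(2 tan y)) ∈ L²(0, π/2)` … it follows that the sequence `(J₂(m))_m` is in `ℓ²`» (Bessel's inequality).

Followed, in the angle variable `t = 2y ∈ (0, π)` of Oesterlé's argument as typed by rh-crit-gm-t14 in
`Voros2006OesterleProofs.lean` (namespace `Voros2006Oesterle`), whose public lemmas ARE the printed steps:
the Stieltjes integration by parts is `tsum_eq_integral` (`Σ_k 2(1 − cos nϑ_k) = ∫₀^∞ Ñ(t)·2n sin(nt) dt`,
`Ñ(t) = N(½cot(t/2))`), the split `dN = smooth + dS` is `integral_split` with the error
`E = Ñ − 𝟙_{(0,π)} M`, `M(t) = main(1/t)`, and the smooth part is evaluated by `integral_M_mul_sin`.  This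
gives, for `n ≥ 1`, the EXACT identity (S5 below, divided by `n`)
`λ̃_n/n − 2π[2R₂(log n − 1 + γ) + R₁] = 2·[4R₂·log n·(Si(nπ) − π/2) − 4R₂·(L(nπ) + πγ/2)
  + (2R₁ − 4R₂)(Si(nπ) − π/2) + ∫₀^π E(t) sin(nt) dt]`, `L(A) = ∫₀^A log s·sin s/s ds`.
DEVIATION (said so): the printed `O(log m/m)` for `J₁` is obtained here not from the two definite integrals
but from the RATES `|Si(x) − π/2| ≤ 2/x` (tree, `abs_sinIntegral_sub_pi_div_two_le`) and
`|L(A) + πγ/2| ≤ 2(1 + log A)/A` (S1 below: one integration by parts on `[A, B]`, `B → ∞` through the tree's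
`tendsto_intervalIntegral_sin_mul_log_div`) — the same two constants `π/2` and `−πγ/2` in primitive form;
and the printed `J₂ ∈ ℓ²` is Bessel's inequality for `{sin nt}` on `(0, π)` proved by hand (S3), with
`E ∈ L²(0, π)` because `|E(t)| ≤ K + C t^{−a}` with `a < 1/2` (S2 = gm-t14's `exists_error_bound` with the
exponent exposed; the hypothesis `S(t) = O(log t)` is used in the weaker form `O(t^α)`, `α < 1/2`).

## Contents

* S1 `abs_logSineIntegral_add_le` — the log-sine tail rate.
* S2 `exists_error_bound_exp` — `|E(t)| ≤ K + C·t^{−max α 0}` on `(0, π)`.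
* S3 `sum_sq_integral_mul_sin_le` — Bessel: `Σ_{n=1}^N (∫₀^π E sin(n·))² ≤ (π/2) ∫₀^π E²`.
* S4 square-summability of the four pieces.
* S5 `keiperSum_sub_main_eq` (the exact identity) and **`sq_summable_keiperSum_div_sub_main`** =
  Theorem 3.1 in the `(NT)` vocabulary of `Voros2006_NT_REs` (any exponent `α < 1/2`), with the printed
  normalisation `AriasDeReyna2011_thm31` (`(4/m) Σ sin²(m θ_j)`, `θ_j = arctan(1/2τ_j)`) and the verbatim
  `S(t) = O(log t)` form `AriasDeReyna2011_thm31_of_isBigO_log`.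
* S6 the `ζ` instance under RH: **`AriasDeReyna2011_cor31_holds`**, and the now hypothesis-free
  `AriasDeReyna2011_thm43_holds` (RH ⟺ `(A_n) ∈ ℓ²`), `AriasDeReyna2011_thm_main_holds` (RH ⟺ `(y_m) ∈ ℓ²`).

No definitions, no named facts (D-0026).
-/

noncomputable section

open Filter Topology Asymptotics Set MeasureTheory Real

namespace Literature.NumberTheory.LFunctions

namespace AriasDeReyna2011Thm31

open Literature.NumberTheory.ConnesConsani2021 Voros2006Oesterle

/-! ## S1. The log-sine tail: `|∫₀^A log s·sin s/s ds + πγ/2| ≤ 2(1 + log A)/A` for `A ≥ 1` -/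

/-- Integration by parts on `[A, B]`, `1 ≤ A ≤ B`:
`∫_A^B log s·sin s/s ds = cos A log A/A − cos B log B/B + ∫_A^B cos s (1 − log s)/s² ds`
(printed form of the step «it is known that … `∫₀^∞ (sin²x/x²) log x dx = π(1−γ−log 2)/2`», here as the
rate of convergence of the conditionally convergent log-sine integral). [cite: AriasDeReyna2011KeiperLi, Thm 3.1 proof p.10] -/
theorem integral_log_mul_sin_div_eq {A B : ℝ} (hA : 1 ≤ A) (hAB : A ≤ B) :
    ∫ s in A..B, Real.log s * (Real.sin s / s) =
      Real.cos A * Real.log A / A - Real.cos B * Real.log B / B +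
        ∫ s in A..B, Real.cos s * (1 - Real.log s) / s ^ 2 := by
  have hk : ContinuousOn (fun t : ℝ ↦ Real.cos t * (1 - Real.log t) / t ^ 2) (Set.uIcc A B) := by
    refine fun t ht ↦ ContinuousAt.continuousWithinAt ?_
    rw [Set.uIcc_of_le hAB] at ht
    have ht0 : t ≠ 0 := by linarith [ht.1]
    exact ((Real.continuous_cos.continuousAt).mul
      (continuousAt_const.sub (Real.continuousAt_log ht0))).div (continuousAt_id.pow 2)
      (pow_ne_zero 2 ht0)
  have hkint : IntervalIntegrable (fun t : ℝ ↦ Real.cos t * (1 - Real.log t) / t ^ 2) volume A B :=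
    hk.intervalIntegrable
  have hg : ContinuousOn (fun t : ℝ ↦ Real.log t * (Real.sin t / t)) (Set.uIcc A B) := by
    refine fun t ht ↦ ContinuousAt.continuousWithinAt ?_
    rw [Set.uIcc_of_le hAB] at ht
    have ht0 : t ≠ 0 := by linarith [ht.1]
    exact (Real.continuousAt_log ht0).mul ((Real.continuous_sin.continuousAt).div continuousAt_id ht0)
  have hgint : IntervalIntegrable (fun t : ℝ ↦ Real.log t * (Real.sin t / t)) volume A B :=
    hg.intervalIntegrable
  have hderiv : ∀ t ∈ Ioo A B, HasDerivAt (fun t : ℝ ↦ -(Real.cos t * Real.log t / t))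
      (Real.log t * (Real.sin t / t) - Real.cos t * (1 - Real.log t) / t ^ 2) t := by
    intro t ht
    have ht0 : t ≠ 0 := by linarith [ht.1]
    have h := (((Real.hasDerivAt_cos t).mul (Real.hasDerivAt_log ht0)).div (hasDerivAt_id t)
      ht0).neg
    refine h.congr_deriv ?_
    simp only [id, Pi.mul_apply]
    field_simp
    ring
  have hcont : ContinuousOn (fun t : ℝ ↦ -(Real.cos t * Real.log t / t)) (Icc A B) := by
    refine fun t ht ↦ ContinuousAt.continuousWithinAt ?_
    have ht0 : t ≠ 0 := by linarith [ht.1]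
    exact (((Real.continuous_cos.continuousAt).mul (Real.continuousAt_log ht0)).div
      continuousAt_id ht0).neg
  have hint : IntervalIntegrable (fun t : ℝ ↦
      Real.log t * (Real.sin t / t) - Real.cos t * (1 - Real.log t) / t ^ 2) volume A B :=
    hgint.sub hkint
  have hFTC := intervalIntegral.integral_eq_sub_of_hasDerivAt_of_le hAB hcont hderiv hint
  rw [intervalIntegral.integral_sub hgint hkint] at hFTC
  have : ∫ s in A..B, Real.log s * (Real.sin s / s) =
      (-(Real.cos B * Real.log B / B) - -(Real.cos A * Real.log A / A)) +
        ∫ s in A..B, Real.cos s * (1 - Real.log s) / s ^ 2 := by linarith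
  rw [this]
  ring

/-- The tail majorant: `∫_A^B (1 + log s)/s² ds = (2 + log A)/A − (2 + log B)/B` for `1 ≤ A ≤ B`.
[cite: AriasDeReyna2011KeiperLi, Thm 3.1 proof p.10] -/
theorem integral_one_add_log_div_sq {A B : ℝ} (hA : 1 ≤ A) (hAB : A ≤ B) :
    ∫ s in A..B, (1 + Real.log s) / s ^ 2 = (2 + Real.log A) / A - (2 + Real.log B) / B := by
  have hderiv : ∀ t ∈ Ioo A B, HasDerivAt (fun t : ℝ ↦ -((2 + Real.log t) / t))
      ((1 + Real.log t) / t ^ 2) t := by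
    intro t ht
    have ht0 : t ≠ 0 := by linarith [ht.1]
    have h := (((hasDerivAt_id t).log ht0).const_add 2).div (hasDerivAt_id t) ht0
    have h' := h.neg
    refine h'.congr_deriv ?_
    simp only [id]
    field_simp
    ring
  have hcont : ContinuousOn (fun t : ℝ ↦ -((2 + Real.log t) / t)) (Icc A B) := by
    refine fun t ht ↦ ContinuousAt.continuousWithinAt ?_
    have ht0 : t ≠ 0 := by linarith [ht.1]
    exact ((continuousAt_const.add (Real.continuousAt_log ht0)).div continuousAt_id ht0).neg
  have hint : IntervalIntegrable (fun t : ℝ ↦ (1 + Real.log t) / t ^ 2) volume A B := by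
    refine ContinuousOn.intervalIntegrable fun t ht ↦ ContinuousAt.continuousWithinAt ?_
    rw [Set.uIcc_of_le hAB] at ht
    have ht0 : t ≠ 0 := by linarith [ht.1]
    exact (continuousAt_const.add (Real.continuousAt_log ht0)).div (continuousAt_id.pow 2)
      (pow_ne_zero 2 ht0)
  rw [intervalIntegral.integral_eq_sub_of_hasDerivAt_of_le hAB hcont hderiv hint]
  ring

/-- The two-point estimate: for `1 ≤ A ≤ B`,
`|∫_A^B log s·sin s/s ds| ≤ log B/B + (2 + 2 log A)/A`. [cite: AriasDeReyna2011KeiperLi, Thm 3.1 proof p.10] -/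
theorem abs_integral_log_mul_sin_div_le {A B : ℝ} (hA : 1 ≤ A) (hAB : A ≤ B) :
    |∫ s in A..B, Real.log s * (Real.sin s / s)| ≤
      Real.log B / B + (2 + 2 * Real.log A) / A := by
  have hA0 : 0 < A := by linarith
  have hB0 : 0 < B := by linarith
  have hlA : 0 ≤ Real.log A := Real.log_nonneg hA
  have hlB : 0 ≤ Real.log B := Real.log_nonneg (hA.trans hAB)
  rw [integral_log_mul_sin_div_eq hA hAB]
  -- the boundary terms
  have hb1 : |Real.cos A * Real.log A / A| ≤ Real.log A / A := by
    rw [abs_div, abs_mul, abs_of_pos hA0, abs_of_nonneg hlA]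
    exact div_le_div_of_nonneg_right (mul_le_of_le_one_left hlA (Real.abs_cos_le_one A)) hA0.le
  have hb2 : |Real.cos B * Real.log B / B| ≤ Real.log B / B := by
    rw [abs_div, abs_mul, abs_of_pos hB0, abs_of_nonneg hlB]
    exact div_le_div_of_nonneg_right (mul_le_of_le_one_left hlB (Real.abs_cos_le_one B)) hB0.le
  -- the integral term
  have hI : |∫ s in A..B, Real.cos s * (1 - Real.log s) / s ^ 2| ≤ (2 + Real.log A) / A := by
    have h1 : |∫ s in A..B, Real.cos s * (1 - Real.log s) / s ^ 2| ≤
        ∫ s in A..B, (1 + Real.log s) / s ^ 2 := by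
      refine intervalIntegral.abs_integral_le_integral_abs hAB |>.trans ?_
      refine intervalIntegral.integral_mono_on hAB ?_ ?_ fun s hs ↦ ?_
      · refine (ContinuousOn.intervalIntegrable fun t ht ↦ ContinuousAt.continuousWithinAt ?_).abs
        rw [Set.uIcc_of_le hAB] at ht
        have ht0 : t ≠ 0 := by linarith [ht.1]
        exact ((Real.continuous_cos.continuousAt).mul
          (continuousAt_const.sub (Real.continuousAt_log ht0))).div (continuousAt_id.pow 2)
          (pow_ne_zero 2 ht0)
      · refine ContinuousOn.intervalIntegrable fun t ht ↦ ContinuousAt.continuousWithinAt ?_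
        rw [Set.uIcc_of_le hAB] at ht
        have ht0 : t ≠ 0 := by linarith [ht.1]
        exact (continuousAt_const.add (Real.continuousAt_log ht0)).div (continuousAt_id.pow 2)
          (pow_ne_zero 2 ht0)
      · have hs0 : 0 < s := by linarith [hs.1]
        have hls : 0 ≤ Real.log s := Real.log_nonneg (hA.trans hs.1)
        rw [abs_div, abs_mul, abs_of_pos (pow_pos hs0 2)]
        refine div_le_div_of_nonneg_right ?_ (pow_pos hs0 2).le
        calc |Real.cos s| * |1 - Real.log s| ≤ 1 * |1 - Real.log s| :=
              mul_le_mul_of_nonneg_right (Real.abs_cos_le_one s) (abs_nonneg _)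
          _ = |1 - Real.log s| := one_mul _
          _ ≤ |(1:ℝ)| + |Real.log s| := abs_sub _ _
          _ = 1 + Real.log s := by rw [abs_one, abs_of_nonneg hls]
    rw [integral_one_add_log_div_sq hA hAB] at h1
    have h2 : 0 ≤ (2 + Real.log B) / B := by positivity
    linarith
  calc |Real.cos A * Real.log A / A - Real.cos B * Real.log B / B +
        ∫ s in A..B, Real.cos s * (1 - Real.log s) / s ^ 2|
      ≤ |Real.cos A * Real.log A / A - Real.cos B * Real.log B / B| +
          |∫ s in A..B, Real.cos s * (1 - Real.log s) / s ^ 2| := abs_add_le _ _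
    _ ≤ (|Real.cos A * Real.log A / A| + |Real.cos B * Real.log B / B|) + (2 + Real.log A) / A :=
          add_le_add (abs_sub _ _) hI
    _ ≤ (Real.log A / A + Real.log B / B) + (2 + Real.log A) / A := by linarith
    _ = Real.log B / B + (2 + 2 * Real.log A) / A := by ring

/-- **The log-sine tail rate**: `|∫₀^A log s·(sin s/s) ds + πγ/2| ≤ (2 + 2 log A)/A` for `A ≥ 1`
(`∫₀^∞ log s·sin s/s ds = −πγ/2`, Gradshteyn–Ryzhik 4.421 1, is the tree's `tendsto_logSineIntegral`).
[cite: AriasDeReyna2011KeiperLi, Thm 3.1 proof pp.10–11] -/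
theorem abs_logSineIntegral_add_le {A : ℝ} (hA : 1 ≤ A) :
    |(∫ s in (0:ℝ)..A, Real.log s * (Real.sin s / s)) + π / 2 * Real.eulerMascheroniConstant| ≤
      (2 + 2 * Real.log A) / A := by
  set L : ℝ → ℝ := fun B ↦ ∫ s in (0:ℝ)..B, Real.log s * (Real.sin s / s) with hL
  have hlim : Tendsto L atTop (𝓝 (-(π / 2) * Real.eulerMascheroniConstant)) := tendsto_logSineIntegral
  -- `L B − L A` is the integral over `[A, B]`
  have hsplit : ∀ B, A ≤ B → L B - L A = ∫ s in A..B, Real.log s * (Real.sin s / s) := by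
    intro B hAB
    rw [hL]
    dsimp only
    rw [← intervalIntegral.integral_add_adjacent_intervals
      (intervalIntegrable_log_mul_sin_div 0 A) (intervalIntegrable_log_mul_sin_div A B)]
    ring
  have hev : ∀ᶠ B in atTop, |L B - L A| ≤ Real.log B / B + (2 + 2 * Real.log A) / A := by
    filter_upwards [eventually_ge_atTop A] with B hAB
    rw [hsplit B hAB]
    exact abs_integral_log_mul_sin_div_le hA hAB
  have hlim1 : Tendsto (fun B ↦ |L B - L A|) atTop
      (𝓝 |-(π / 2) * Real.eulerMascheroniConstant - L A|) := (hlim.sub_const (L A)).abs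
  have hlim2 : Tendsto (fun B : ℝ ↦ Real.log B / B + (2 + 2 * Real.log A) / A) atTop
      (𝓝 (0 + (2 + 2 * Real.log A) / A)) := by
    have h := Real.tendsto_pow_log_div_mul_add_atTop 1 0 1 one_ne_zero
    have h' : Tendsto (fun B : ℝ ↦ Real.log B / B) atTop (𝓝 0) := by
      refine h.congr' (Eventually.of_forall fun B ↦ ?_)
      simp
    exact h'.add_const _
  have := le_of_tendsto_of_tendsto hlim1 hlim2 hev
  rw [zero_add] at this
  calc |L A + π / 2 * Real.eulerMascheroniConstant|
      = |-(π / 2) * Real.eulerMascheroniConstant - L A| := by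
        rw [← abs_neg]; congr 1; ring
    _ ≤ (2 + 2 * Real.log A) / A := this

/-! ## S4 (first part). Elementary square-summable majorants -/

/-- `Σ_n (1 + log n)²/n² < ∞` (compare with `n^{−3/2}` via `log n ≤ 4 n^{1/4}`). [folklore] -/
private theorem summable_one_add_log_sq_div_sq :
    Summable (fun n : ℕ ↦ (1 + Real.log n) ^ 2 / (n : ℝ) ^ 2) := by
  have hmaj : Summable (fun n : ℕ ↦ 50 * ((n : ℝ) ^ (3 / 2 : ℝ))⁻¹) :=
    ((Real.summable_nat_rpow_inv.2 (by norm_num : (1:ℝ) < 3 / 2)).mul_left 50)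
  refine Summable.of_nonneg_of_le (fun n ↦ by positivity) (fun n ↦ ?_) hmaj
  rcases Nat.eq_zero_or_pos n with rfl | hn
  · simp
  have hn1 : (1 : ℝ) ≤ n := by exact_mod_cast hn
  have hn0 : (0 : ℝ) < n := by linarith
  have hlog : Real.log n ≤ (n : ℝ) ^ (1 / 4 : ℝ) / (1 / 4) :=
    Real.log_le_rpow_div hn0.le (by norm_num)
  have hlog0 : 0 ≤ Real.log n := Real.log_nonneg hn1
  have hq : 1 ≤ (n : ℝ) ^ (1 / 4 : ℝ) := Real.one_le_rpow hn1 (by norm_num)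
  -- `1 + log n ≤ 5 n^{1/4}`
  have h1 : 1 + Real.log n ≤ 5 * (n : ℝ) ^ (1 / 4 : ℝ) := by linarith
  have h2 : (1 + Real.log n) ^ 2 ≤ 25 * (n : ℝ) ^ (1 / 2 : ℝ) := by
    have := pow_le_pow_left₀ (by positivity) h1 2
    have e : (5 * (n : ℝ) ^ (1 / 4 : ℝ)) ^ 2 = 25 * (n : ℝ) ^ (1 / 2 : ℝ) := by
      rw [mul_pow, sq ((n : ℝ) ^ (1 / 4 : ℝ)), ← Real.rpow_add hn0]; norm_num
    linarith
  have hn2 : (n : ℝ) ^ 2 = (n : ℝ) ^ (2 : ℝ) := by rw [← Real.rpow_natCast]; norm_num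
  have hpow : (n : ℝ) ^ (1 / 2 : ℝ) / (n : ℝ) ^ 2 = ((n : ℝ) ^ (3 / 2 : ℝ))⁻¹ := by
    rw [hn2, ← Real.rpow_sub hn0, ← Real.rpow_neg hn0.le]; norm_num
  calc (1 + Real.log n) ^ 2 / (n : ℝ) ^ 2 ≤ 25 * (n : ℝ) ^ (1 / 2 : ℝ) / (n : ℝ) ^ 2 :=
        div_le_div_of_nonneg_right h2 (by positivity)
    _ = 25 * ((n : ℝ) ^ (3 / 2 : ℝ))⁻¹ := by rw [mul_div_assoc, hpow]
    _ ≤ 50 * ((n : ℝ) ^ (3 / 2 : ℝ))⁻¹ := by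
        have : 0 ≤ ((n : ℝ) ^ (3 / 2 : ℝ))⁻¹ := by positivity
        linarith

/-- A sequence eventually bounded by `c(1 + log n)/n` in absolute value is square-summable. [folklore] -/
private theorem summable_sq_of_abs_le {f : ℕ → ℝ} {c : ℝ} {n₀ : ℕ}
    (h : ∀ n, n₀ ≤ n → |f n| ≤ c * ((1 + Real.log n) / n)) :
    Summable (fun n : ℕ ↦ f n ^ 2) := by
  have hmaj := (summable_one_add_log_sq_div_sq.mul_left (c ^ 2))
  refine (summable_nat_add_iff n₀).1 ?_
  refine Summable.of_nonneg_of_le (fun n ↦ sq_nonneg _) (fun n ↦ ?_)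
    ((summable_nat_add_iff n₀).2 hmaj)
  have hb := h (n + n₀) (Nat.le_add_left _ _)
  have h0 : 0 ≤ c * ((1 + Real.log ↑(n + n₀)) / ↑(n + n₀)) := (abs_nonneg _).trans hb
  calc f (n + n₀) ^ 2 = |f (n + n₀)| ^ 2 := (sq_abs _).symm
    _ ≤ (c * ((1 + Real.log ↑(n + n₀)) / ↑(n + n₀))) ^ 2 := pow_le_pow_left₀ (abs_nonneg _) hb 2
    _ = c ^ 2 * ((1 + Real.log ↑(n + n₀)) ^ 2 / (↑(n + n₀) : ℝ) ^ 2) := by rw [mul_pow, div_pow]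


/-! ## S2. The error `E = Ñ − 𝟙_{(0,π)}·M` is `O(t^{−a})` with the exponent `a = max α 0` EXPOSED -/

/-- gm-t14's `Voros2006Oesterle.exists_error_bound` with the exponent made explicit: under `(NT)` with
exponent `α`, `|Ñ(t) − M(t)| ≤ K + C·t^{−max α 0}` on `(0, π)` (same proof, verbatim; the original hides the
exponent behind `∃ a < 1`, which does not suffice for square-integrability).  For `α < 1/2` this makes
`E ∈ L²(0, π)` — the printed «`S(1/(2 tan y)) ∈ L²(0, π/2)` since `∫₀^∞ S(x)² 2dx/(1+4x²) < +∞`».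
[cite: AriasDeReyna2011KeiperLi, Thm 3.1 proof p.11; Voros2006, §3 p.5–6] -/
theorem exists_error_bound_exp {τ : ℕ → ℝ} {R₂ R₁ α : ℝ} (hτ : ∀ k, 0 < τ k) (hmono : Monotone τ)
    (hlim : Tendsto τ atTop atTop) (hα : α < 1)
    (hNT : (fun T : ℝ ↦ (Nat.card {k : ℕ | τ k ≤ T} : ℝ) - 2 * T * (2 * R₂ * (Real.log T - 1) + R₁))
      =O[atTop] (fun T : ℝ ↦ T ^ α)) :
    ∃ K C : ℝ, 0 ≤ K ∧ 0 ≤ C ∧ ∀ t ∈ Ioo (0:ℝ) π,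
      |(({k : ℕ | t ≤ 2 * Real.arctan (1 / (2 * τ k))} : Set ℕ).ncard : ℝ) -
          2 * (1 / t) * (2 * R₂ * (Real.log (1 / t) - 1) + R₁)| ≤ K + C * t ^ (-(max α 0)) := by
  obtain ⟨C₀, T₀, hC₀, hT₀, hB⟩ := exists_NT_bound hNT
  have hsum := summable_theta_sq hτ hmono hlim hα hNT
  set a : ℝ := max α 0 with ha
  have ha0 : 0 ≤ a := le_max_right _ _
  have ha1 : a < 1 := max_lt hα one_pos
  set t₀ : ℝ := min 1 (1 / (T₀ + 1)) with ht₀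
  have ht₀0 : 0 < t₀ := lt_min one_pos (by positivity)
  have ht₀1 : t₀ ≤ 1 := min_le_left _ _
  have ht₀π : t₀ < π := lt_of_le_of_lt ht₀1 (by linarith [Real.pi_gt_three])
  -- the constants
  set K₂ : ℝ := |R₂| + |2 * R₁ - 4 * R₂| with hK₂
  set N₀ : ℝ := (({k : ℕ | t₀ ≤ 2 * Real.arctan (1 / (2 * τ k))} : Set ℕ).ncard : ℝ) with hN₀
  set K₃ : ℝ := 2 / t₀ * (2 * |R₂| * (|Real.log t₀| + |Real.log π| + 1) + |R₁|) with hK₃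
  have hK₂0 : 0 ≤ K₂ := by positivity
  have hN₀0 : 0 ≤ N₀ := Nat.cast_nonneg _
  have hK₃0 : 0 ≤ K₃ := by positivity
  refine ⟨K₂ + N₀ + K₃, C₀, by positivity, hC₀, fun t ht => ?_⟩
  obtain ⟨ht0, htπ⟩ := ht
  have hta : 0 ≤ C₀ * t ^ (-a) := mul_nonneg hC₀ (Real.rpow_nonneg ht0.le _)
  rcases le_or_gt t t₀ with hle | hgt
  · -- small `t`: use `(NT)` at `T(t)` and the smooth comparison
    have ht1 : t ≤ 1 := hle.trans ht₀1
    set T : ℝ := 1 / (2 * Real.tan (t / 2)) with hT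
    have hTlo : 1 / t - t / 8 ≤ T := Tinv_ge ht0 htπ
    have hThi : T ≤ 1 / t := Tinv_le ht0 htπ
    have h1t : T₀ + 1 ≤ 1 / t := by
      have h1 : t ≤ 1 / (T₀ + 1) := hle.trans (min_le_right _ _)
      rw [le_one_div (by positivity) ht0]  -- ? careful
      exact h1
    have hT₀T : T₀ ≤ T := by linarith
    have hT1 : 1 ≤ T := hT₀.trans hT₀T
    have hT0 : 0 < T := by linarith
    -- `Ñ(t) = N(T)`
    have hNN : (({k : ℕ | t ≤ 2 * Real.arctan (1 / (2 * τ k))} : Set ℕ).ncard : ℝ) =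
        (({k : ℕ | τ k ≤ T} : Set ℕ).ncard : ℝ) := by
      rw [setOf_le_theta_eq hτ ht0 htπ]
    -- `(NT)` at `T`
    have hNT' := hB T hT₀T
    have hpow : C₀ * T ^ a ≤ C₀ * t ^ (-a) := by
      apply mul_le_mul_of_nonneg_left _ hC₀
      calc T ^ a ≤ (1 / t) ^ a := Real.rpow_le_rpow hT0.le hThi ha0
        _ = t ^ (-a) := by rw [one_div, Real.inv_rpow ht0.le, Real.rpow_neg ht0.le]
    -- smooth comparison
    have hsm := abs_smooth_sub_le (R₂ := R₂) (R₁ := R₁) ht0 ht1 hT1 hTlo hThi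
    rw [hNN]
    have : (({k : ℕ | τ k ≤ T} : Set ℕ).ncard : ℝ) - 2 * (1 / t) * (2 * R₂ * (Real.log (1 / t) - 1) + R₁) =
        ((({k : ℕ | τ k ≤ T} : Set ℕ).ncard : ℝ) - 2 * T * (2 * R₂ * (Real.log T - 1) + R₁)) +
        (2 * T * (2 * R₂ * (Real.log T - 1) + R₁) - 2 * (1 / t) * (2 * R₂ * (Real.log (1 / t) - 1) + R₁)) := by
      ring
    rw [this]
    calc _ ≤ |(({k : ℕ | τ k ≤ T} : Set ℕ).ncard : ℝ) - 2 * T * (2 * R₂ * (Real.log T - 1) + R₁)| +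
          |2 * T * (2 * R₂ * (Real.log T - 1) + R₁) - 2 * (1 / t) * (2 * R₂ * (Real.log (1 / t) - 1) + R₁)| :=
          abs_add_le _ _
      _ ≤ C₀ * T ^ a + K₂ := add_le_add hNT' hsm
      _ ≤ C₀ * t ^ (-a) + K₂ := by linarith
      _ ≤ K₂ + N₀ + K₃ + C₀ * t ^ (-a) := by linarith
  · -- `t ∈ (t₀, π)`: everything is bounded
    have hanti := antitoneOn_count (ϑ := fun k => 2 * Real.arctan (1 / (2 * τ k))) hsum
    have hNle : (({k : ℕ | t ≤ 2 * Real.arctan (1 / (2 * τ k))} : Set ℕ).ncard : ℝ) ≤ N₀ := by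
      have := hanti (show t₀ ∈ Ioi (0:ℝ) from ht₀0) (show t ∈ Ioi (0:ℝ) from ht0) hgt.le
      dsimp only at this
      rw [hN₀]
      exact this
    have hN0 : 0 ≤ (({k : ℕ | t ≤ 2 * Real.arctan (1 / (2 * τ k))} : Set ℕ).ncard : ℝ) := Nat.cast_nonneg _
    have hM := abs_M_le (R₂ := R₂) (R₁ := R₁) ht₀0 hgt.le htπ.le
    calc _ ≤ |(({k : ℕ | t ≤ 2 * Real.arctan (1 / (2 * τ k))} : Set ℕ).ncard : ℝ)| +
          |2 * (1 / t) * (2 * R₂ * (Real.log (1 / t) - 1) + R₁)| := abs_sub _ _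
      _ ≤ N₀ + K₃ := add_le_add (by rwa [abs_of_nonneg hN0]) hM
      _ ≤ K₂ + N₀ + K₃ + C₀ * t ^ (-a) := by linarith





/-! ## S3. Bessel's inequality for `{sin nt}` on `(0, π)` (by hand) -/

/-- `∫₀^π cos(kt) dt = 0` for a non-zero integer `k`. [folklore] -/
private theorem integral_cos_int_mul {k : ℤ} (hk : k ≠ 0) :
    ∫ t in (0:ℝ)..π, Real.cos (k * t) = 0 := by
  have hk' : (k : ℝ) ≠ 0 := by exact_mod_cast hk
  rw [intervalIntegral.integral_comp_mul_left (fun x ↦ Real.cos x) hk', mul_zero, integral_cos,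
    Real.sin_zero, sub_zero, Real.sin_int_mul_pi, smul_zero]

/-- Orthogonality: `∫₀^π sin((n+1)t) sin((m+1)t) dt = (π/2)·[n = m]`. [folklore] -/
private theorem integral_sin_mul_sin (n m : ℕ) :
    ∫ t in (0:ℝ)..π, Real.sin (((n:ℝ) + 1) * t) * Real.sin (((m:ℝ) + 1) * t) =
      if n = m then π / 2 else 0 := by
  have hprod : ∀ t : ℝ, Real.sin (((n:ℝ) + 1) * t) * Real.sin (((m:ℝ) + 1) * t) =
      (Real.cos ((((n:ℤ) - m : ℤ) : ℝ) * t) - Real.cos ((((n:ℤ) + m + 2 : ℤ) : ℝ) * t)) / 2 := by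
    intro t
    have e1 : (((n:ℤ) - m : ℤ) : ℝ) * t = ((n:ℝ) + 1) * t - ((m:ℝ) + 1) * t := by push_cast; ring
    have e2 : (((n:ℤ) + m + 2 : ℤ) : ℝ) * t = ((n:ℝ) + 1) * t + ((m:ℝ) + 1) * t := by push_cast; ring
    rw [e1, e2, Real.cos_sub, Real.cos_add]; ring
  simp_rw [hprod]
  have hi1 : IntervalIntegrable (fun t : ℝ ↦ Real.cos ((((n:ℤ) - m : ℤ) : ℝ) * t)) volume 0 π :=
    (Real.continuous_cos.comp (continuous_const.mul continuous_id)).intervalIntegrable _ _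
  have hi2 : IntervalIntegrable (fun t : ℝ ↦ Real.cos ((((n:ℤ) + m + 2 : ℤ) : ℝ) * t)) volume 0 π :=
    (Real.continuous_cos.comp (continuous_const.mul continuous_id)).intervalIntegrable _ _
  rw [intervalIntegral.integral_div, intervalIntegral.integral_sub hi1 hi2,
    integral_cos_int_mul (k := (n:ℤ) + m + 2) (by omega)]
  by_cases h : n = m
  · subst h
    simp
  · rw [integral_cos_int_mul (k := (n:ℤ) - m) (by omega), if_neg h]
    simp

/-- **Bessel's inequality for the sine system on `(0, π)`** (the printed «it follows that the sequence
`(J₂(m))_m` is in `ℓ²`»): for a real function `E` with `E`, `E²` integrable on `[0, π]` and every `N`,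
`Σ_{n<N} (∫₀^π E(t) sin((n+1)t) dt)² ≤ (π/2) ∫₀^π E²`.  Proof by hand: with `c_n` the coefficients and
`P = Σ_{n<N} c_n sin((n+1)·)`, `0 ≤ ∫ (E − (2/π)P)² = ∫E² − (2/π) Σ c_n²`.
[cite: AriasDeReyna2011KeiperLi, Thm 3.1 proof p.11] -/
theorem sum_sq_integral_mul_sin_le {E : ℝ → ℝ} (hE : IntervalIntegrable E volume 0 π)
    (hE2 : IntervalIntegrable (fun t ↦ E t ^ 2) volume 0 π) (N : ℕ) :
    ∑ n ∈ Finset.range N, (∫ t in (0:ℝ)..π, E t * Real.sin (((n:ℝ) + 1) * t)) ^ 2 ≤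
      π / 2 * ∫ t in (0:ℝ)..π, E t ^ 2 := by
  set c : ℕ → ℝ := fun n ↦ ∫ t in (0:ℝ)..π, E t * Real.sin (((n:ℝ) + 1) * t) with hc
  set P : ℝ → ℝ := fun t ↦ ∑ n ∈ Finset.range N, c n * Real.sin (((n:ℝ) + 1) * t) with hP
  set S : ℝ := ∑ n ∈ Finset.range N, c n ^ 2 with hS
  have hsin_cont : ∀ n : ℕ, Continuous (fun t : ℝ ↦ Real.sin (((n:ℝ) + 1) * t)) :=
    fun n ↦ Real.continuous_sin.comp (continuous_const.mul continuous_id)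
  have hPc : Continuous P := by
    refine continuous_finsetSum _ fun n _ ↦ continuous_const.mul (hsin_cont n)
  -- (1) `∫ E·P = S`
  have hEsin : ∀ n : ℕ, IntervalIntegrable (fun t ↦ E t * Real.sin (((n:ℝ) + 1) * t)) volume 0 π :=
    fun n ↦ hE.mul_continuousOn (hsin_cont n).continuousOn
  have h1 : ∫ t in (0:ℝ)..π, E t * P t = S := by
    have e : ∀ t, E t * P t = ∑ n ∈ Finset.range N, c n * (E t * Real.sin (((n:ℝ) + 1) * t)) := by
      intro t
      rw [hP]
      dsimp only
      rw [Finset.mul_sum]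
      refine Finset.sum_congr rfl fun n _ ↦ by ring
    simp_rw [e]
    rw [intervalIntegral.integral_finsetSum (fun n _ ↦ (hEsin n).const_mul (c n))]
    refine Finset.sum_congr rfl fun n _ ↦ ?_
    rw [intervalIntegral.integral_const_mul]
    change c n * c n = c n ^ 2
    ring
  -- (2) `∫ P² = (π/2) S`
  have h2 : ∫ t in (0:ℝ)..π, P t ^ 2 = π / 2 * S := by
    have e : ∀ t, P t ^ 2 = ∑ n ∈ Finset.range N, ∑ m ∈ Finset.range N,
        c n * c m * (Real.sin (((n:ℝ) + 1) * t) * Real.sin (((m:ℝ) + 1) * t)) := by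
      intro t
      rw [hP]
      dsimp only
      rw [sq, Finset.sum_mul_sum]
      refine Finset.sum_congr rfl fun n _ ↦ Finset.sum_congr rfl fun m _ ↦ by ring
    simp_rw [e]
    have hint : ∀ n m : ℕ, IntervalIntegrable
        (fun t ↦ c n * c m * (Real.sin (((n:ℝ) + 1) * t) * Real.sin (((m:ℝ) + 1) * t))) volume 0 π :=
      fun n m ↦ (((hsin_cont n).mul (hsin_cont m)).intervalIntegrable _ _).const_mul _
    have hint2 : ∀ n : ℕ, IntervalIntegrable (fun t ↦ ∑ m ∈ Finset.range N,
        c n * c m * (Real.sin (((n:ℝ) + 1) * t) * Real.sin (((m:ℝ) + 1) * t))) volume 0 π :=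
      fun n ↦ (continuous_finsetSum _ fun m _ ↦
        continuous_const.mul ((hsin_cont n).mul (hsin_cont m))).intervalIntegrable _ _
    rw [intervalIntegral.integral_finsetSum (fun n _ ↦ hint2 n)]
    have e2 : ∀ n ∈ Finset.range N, (∫ t in (0:ℝ)..π, ∑ m ∈ Finset.range N,
        c n * c m * (Real.sin (((n:ℝ) + 1) * t) * Real.sin (((m:ℝ) + 1) * t))) = π / 2 * c n ^ 2 := by
      intro n hn
      rw [intervalIntegral.integral_finsetSum (fun m _ ↦ hint n m)]
      have e3 : ∀ m ∈ Finset.range N, (∫ t in (0:ℝ)..π,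
          c n * c m * (Real.sin (((n:ℝ) + 1) * t) * Real.sin (((m:ℝ) + 1) * t))) =
          c n * c m * (if n = m then π / 2 else 0) := by
        intro m _
        rw [intervalIntegral.integral_const_mul, integral_sin_mul_sin]
      rw [Finset.sum_congr rfl e3]
      simp_rw [mul_ite, mul_zero]
      rw [Finset.sum_ite_eq, if_pos hn]
      ring
    rw [Finset.sum_congr rfl e2, ← Finset.mul_sum, hS]
  -- (3) `0 ≤ ∫ (E − (2/π)P)² = ∫E² − (2/π) S`
  have hEP : IntervalIntegrable (fun t ↦ E t * P t) volume 0 π := hE.mul_continuousOn hPc.continuousOn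
  have hP2 : IntervalIntegrable (fun t ↦ P t ^ 2) volume 0 π := (hPc.pow 2).intervalIntegrable _ _
  have h3 : ∫ t in (0:ℝ)..π, (E t - 2 / π * P t) ^ 2 =
      (∫ t in (0:ℝ)..π, E t ^ 2) - 2 / π * S := by
    have e : ∀ t, (E t - 2 / π * P t) ^ 2 = (E t ^ 2 - (4 / π) * (E t * P t)) + (2 / π) ^ 2 * P t ^ 2 := by
      intro t; ring
    simp_rw [e]
    rw [intervalIntegral.integral_add (hE2.sub (hEP.const_mul _)) (hP2.const_mul _),
      intervalIntegral.integral_sub hE2 (hEP.const_mul _), intervalIntegral.integral_const_mul,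
      intervalIntegral.integral_const_mul, h1, h2]
    have hπ : π ≠ 0 := Real.pi_pos.ne'
    field_simp
    ring
  have h4 : 0 ≤ ∫ t in (0:ℝ)..π, (E t - 2 / π * P t) ^ 2 :=
    intervalIntegral.integral_nonneg Real.pi_pos.le fun t _ ↦ sq_nonneg _
  rw [h3] at h4
  have hπ : 0 < π := Real.pi_pos
  -- `(2/π) S ≤ ∫E²` ⇒ `S ≤ (π/2) ∫E²`
  have : 2 / π * S ≤ ∫ t in (0:ℝ)..π, E t ^ 2 := by linarith
  calc S = π / 2 * (2 / π * S) := by field_simp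
    _ ≤ π / 2 * ∫ t in (0:ℝ)..π, E t ^ 2 := mul_le_mul_of_nonneg_left this (by positivity)

/-- Corollary: the sine coefficients of such an `E` are square-summable, with the Bessel bound.
[cite: AriasDeReyna2011KeiperLi, Thm 3.1 proof p.11] -/
theorem summable_sq_integral_mul_sin {E : ℝ → ℝ} (hE : IntervalIntegrable E volume 0 π)
    (hE2 : IntervalIntegrable (fun t ↦ E t ^ 2) volume 0 π) :
    Summable (fun n : ℕ ↦ (∫ t in (0:ℝ)..π, E t * Real.sin (((n:ℝ) + 1) * t)) ^ 2) := by
  refine summable_of_sum_range_le (c := π / 2 * ∫ t in (0:ℝ)..π, E t ^ 2) (fun n ↦ sq_nonneg _) ?_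
  intro N
  exact sum_sq_integral_mul_sin_le hE hE2 N


/-! ## S4 (second part). Two summability conveniences -/

/-- `(u + v)²` is summable if `u²`, `v²` are. [folklore] -/
private theorem summable_sq_add {u v : ℕ → ℝ} (hu : Summable (fun m ↦ u m ^ 2))
    (hv : Summable (fun m ↦ v m ^ 2)) : Summable (fun m ↦ (u m + v m) ^ 2) := by
  refine Summable.of_nonneg_of_le (fun m ↦ sq_nonneg _) (fun m ↦ ?_) ((hu.add hv).mul_left 2)
  nlinarith [sq_nonneg (u m - v m)]

/-- A real sequence agreeing with a square-summable one from `m = 1` on is square-summable. [folklore] -/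
private theorem summable_sq_of_eqOn_succ {u v : ℕ → ℝ} (hv : Summable (fun m ↦ v m ^ 2))
    (h : ∀ m, 1 ≤ m → u m = v m) : Summable (fun m ↦ u m ^ 2) := by
  rw [← summable_nat_add_iff 1]
  have e : (fun m ↦ u (m + 1) ^ 2) = fun m ↦ v (m + 1) ^ 2 := by
    funext m; rw [h (m + 1) (by omega)]
  rw [e]
  exact (summable_nat_add_iff 1).2 hv

/-! ## S5. The exact identity and Theorem 3.1 in the `(NT)` vocabulary -/

/-- **The exact identity** behind Oesterlé's argument (the printed `J(m) = J₁(m) + J₂(m)` after the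
Stieltjes integration by parts, with `J₁` evaluated in primitive form): for `n ≥ 1`,
`Σ_k 2(1 − Re(1 − 1/ρ_k)ⁿ) − 2πn[2R₂(log n − 1 + γ) + R₁]
 = 2n·[4R₂ log n (Si(nπ) − π/2) − 4R₂ (∫₀^{nπ} log s·sin s/s ds + πγ/2) + (2R₁ − 4R₂)(Si(nπ) − π/2)
   + ∫₀^∞ E(t) sin(nt) dt]`, `E = Ñ − 𝟙_{(0,π)}M` (gm-t14's pieces `tsum_eq_integral`, `integral_split`,
`integral_M_mul_sin` assembled; this is the identity `hid` inside `Voros2006Oesterle.NT_REs_of_logSineIntegral`,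
exported). [cite: AriasDeReyna2011KeiperLi, Thm 3.1 proof p.10; Voros2006, §3 p.5–6] -/
theorem keiperSum_sub_main_eq {τ : ℕ → ℝ} {R₂ R₁ α : ℝ} (hτ : ∀ k, 0 < τ k) (hmono : Monotone τ)
    (hlim : Tendsto τ atTop atTop) (hα : α < 1)
    (hNT : (fun T : ℝ ↦ (Nat.card {k : ℕ | τ k ≤ T} : ℝ) - 2 * T * (2 * R₂ * (Real.log T - 1) + R₁))
      =O[atTop] (fun T : ℝ ↦ T ^ α)) {n : ℕ} (hn : 1 ≤ n) :
    (∑' k : ℕ, 2 * (1 - ((1 - 1 / ((1 / 2 : ℂ) + τ k * Complex.I)) ^ n).re)) -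
        2 * Real.pi * n * (2 * R₂ * (Real.log n - 1 + Real.eulerMascheroniConstant) + R₁) =
      2 * n * (4 * R₂ * (Real.log n * (sinIntegral (n * π) - π / 2)) -
        4 * R₂ * ((∫ s in (0:ℝ)..((n : ℝ) * π), Real.log s * (Real.sin s / s)) +
          π / 2 * Real.eulerMascheroniConstant) +
        (2 * R₁ - 4 * R₂) * (sinIntegral (n * π) - π / 2) +
        ∫ t in Ioi (0:ℝ), ((({k : ℕ | t ≤ 2 * Real.arctan (1 / (2 * τ k))} : Set ℕ).ncard : ℝ) -
          (Ioo (0:ℝ) π).indicator (fun t => 2 * (1 / t) * (2 * R₂ * (Real.log (1 / t) - 1) + R₁)) t) *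
          Real.sin (n * t)) := by
  have hsum := summable_theta_sq hτ hmono hlim hα hNT
  have hn0 : (0 : ℝ) < n := by exact_mod_cast hn
  have e1 : (∑' k : ℕ, 2 * (1 - ((1 - 1 / ((1 / 2 : ℂ) + τ k * Complex.I)) ^ n).re)) =
      ∑' k : ℕ, 2 * (1 - Real.cos (n * (2 * Real.arctan (1 / (2 * τ k))))) :=
    tsum_congr fun k => summand_eq (hτ k) n
  rw [e1, tsum_eq_integral (ϑ := fun k => 2 * Real.arctan (1 / (2 * τ k))) (fun k => (theta_pos (hτ k)).le)
    hsum n, integral_split hτ hmono hlim hα hNT n, integral_M_mul_sin hn0]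
  ring

/-- The error `E` vanishes on `[π, ∞)`, so `∫₀^∞ E(t) sin(ct) dt = ∫₀^π E(t) sin(ct) dt`.
[cite: AriasDeReyna2011KeiperLi, Thm 3.1 proof p.11] -/
theorem integral_error_mul_sin_eq {τ : ℕ → ℝ} {R₂ R₁ α : ℝ} (hτ : ∀ k, 0 < τ k) (hmono : Monotone τ)
    (hlim : Tendsto τ atTop atTop) (hα : α < 1)
    (hNT : (fun T : ℝ ↦ (Nat.card {k : ℕ | τ k ≤ T} : ℝ) - 2 * T * (2 * R₂ * (Real.log T - 1) + R₁))
      =O[atTop] (fun T : ℝ ↦ T ^ α)) (c : ℝ) :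
    ∫ t in Ioi (0:ℝ), ((({k : ℕ | t ≤ 2 * Real.arctan (1 / (2 * τ k))} : Set ℕ).ncard : ℝ) -
        (Ioo (0:ℝ) π).indicator (fun t => 2 * (1 / t) * (2 * R₂ * (Real.log (1 / t) - 1) + R₁)) t) *
        Real.sin (c * t) =
      ∫ t in (0:ℝ)..π, ((({k : ℕ | t ≤ 2 * Real.arctan (1 / (2 * τ k))} : Set ℕ).ncard : ℝ) -
        (Ioo (0:ℝ) π).indicator (fun t => 2 * (1 / t) * (2 * R₂ * (Real.log (1 / t) - 1) + R₁)) t) *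
        Real.sin (c * t) := by
  set F : ℝ → ℝ := fun t ↦ ((({k : ℕ | t ≤ 2 * Real.arctan (1 / (2 * τ k))} : Set ℕ).ncard : ℝ) -
        (Ioo (0:ℝ) π).indicator (fun t => 2 * (1 / t) * (2 * R₂ * (Real.log (1 / t) - 1) + R₁)) t) *
        Real.sin (c * t) with hF
  have hE := integrableOn_error hτ hmono hlim hα hNT
  -- `F = 𝟙_{(0,π]} F` on `(0, ∞)`
  have hzero : ∀ t, π ≤ t → F t = 0 := by
    intro t ht
    have hnmem : t ∉ Ioo (0:ℝ) π := fun h => absurd h.2 (not_lt.2 ht)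
    rw [hF]
    dsimp only
    rw [Set.indicator_of_notMem hnmem, setOf_le_theta_eq_empty ht]
    simp
  have h1 : ∫ t in Ioi (0:ℝ), F t = ∫ t in Ioi (0:ℝ), (Ioc (0:ℝ) π).indicator F t := by
    refine setIntegral_congr_fun measurableSet_Ioi fun t ht ↦ ?_
    by_cases htπ : t ≤ π
    · rw [Set.indicator_of_mem (show t ∈ Ioc (0:ℝ) π from ⟨ht, htπ⟩)]
    · rw [Set.indicator_of_notMem (fun h ↦ htπ h.2), hzero t (not_le.1 htπ).le]
  rw [h1, setIntegral_indicator measurableSet_Ioc,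
    show Ioi (0:ℝ) ∩ Ioc 0 π = Ioc 0 π from Set.inter_eq_right.2 Ioc_subset_Ioi_self,
    ← intervalIntegral.integral_of_le Real.pi_pos.le]

/-- Under `(NT)` with exponent `α < 1/2` the error `E` is square-integrable on `[0, π]` (and integrable):
the printed «`S(1/(2 tan y)) ∈ L²(0, π/2)`». [cite: AriasDeReyna2011KeiperLi, Thm 3.1 proof p.11] -/
theorem intervalIntegrable_error_sq {τ : ℕ → ℝ} {R₂ R₁ α : ℝ} (hτ : ∀ k, 0 < τ k) (hmono : Monotone τ)
    (hlim : Tendsto τ atTop atTop) (hα : α < 1 / 2)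
    (hNT : (fun T : ℝ ↦ (Nat.card {k : ℕ | τ k ≤ T} : ℝ) - 2 * T * (2 * R₂ * (Real.log T - 1) + R₁))
      =O[atTop] (fun T : ℝ ↦ T ^ α)) :
    IntervalIntegrable (fun t : ℝ ↦ (({k : ℕ | t ≤ 2 * Real.arctan (1 / (2 * τ k))} : Set ℕ).ncard : ℝ) -
        (Ioo (0:ℝ) π).indicator (fun t => 2 * (1 / t) * (2 * R₂ * (Real.log (1 / t) - 1) + R₁)) t)
      volume 0 π ∧
    IntervalIntegrable (fun t : ℝ ↦ ((({k : ℕ | t ≤ 2 * Real.arctan (1 / (2 * τ k))} : Set ℕ).ncard : ℝ) -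
        (Ioo (0:ℝ) π).indicator (fun t => 2 * (1 / t) * (2 * R₂ * (Real.log (1 / t) - 1) + R₁)) t) ^ 2)
      volume 0 π := by
  have hα1 : α < 1 := by linarith
  have hE := integrableOn_error hτ hmono hlim hα1 hNT
  have hE' : IntegrableOn (fun t : ℝ ↦ (({k : ℕ | t ≤ 2 * Real.arctan (1 / (2 * τ k))} : Set ℕ).ncard : ℝ) -
        (Ioo (0:ℝ) π).indicator (fun t => 2 * (1 / t) * (2 * R₂ * (Real.log (1 / t) - 1) + R₁)) t)
      (Ioo 0 π) := hE.mono_set Ioo_subset_Ioi_self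
  refine ⟨(intervalIntegrable_iff_integrableOn_Ioo_of_le Real.pi_pos.le).2 hE', ?_⟩
  obtain ⟨K, C, hK, hC, hb⟩ := exists_error_bound_exp hτ hmono hlim hα1 hNT
  set a : ℝ := max α 0 with ha
  have ha0 : 0 ≤ a := le_max_right _ _
  have ha2 : 2 * a < 1 := by
    rcases le_or_gt α 0 with h | h
    · rw [ha, max_eq_right h]; norm_num
    · rw [ha, max_eq_left h.le]; linarith
  rw [intervalIntegrable_iff_integrableOn_Ioo_of_le Real.pi_pos.le]
  -- majorant `2K² + 2C² t^{−2a}` on `(0, π)`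
  have hg : IntegrableOn (fun t : ℝ ↦ 2 * K ^ 2 + 2 * C ^ 2 * t ^ (-(2 * a))) (Ioo 0 π) := by
    have h1 : IntervalIntegrable (fun t : ℝ ↦ 2 * K ^ 2 + 2 * C ^ 2 * t ^ (-(2 * a))) volume 0 π :=
      intervalIntegrable_const.add ((intervalIntegral.intervalIntegrable_rpow' (by linarith)).const_mul _)
    exact (intervalIntegrable_iff_integrableOn_Ioo_of_le Real.pi_pos.le).1 h1
  refine Integrable.mono' hg (hE'.aestronglyMeasurable.pow 2)
    (ae_restrict_of_forall_mem measurableSet_Ioo fun t ht ↦ ?_)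
  have hbt := hb t ht
  have ht0 : 0 < t := ht.1
  rw [Real.norm_eq_abs, abs_pow, sq_abs]
  have hx : 0 ≤ C * t ^ (-a) := mul_nonneg hC (Real.rpow_nonneg ht0.le _)
  have habs : |(({k : ℕ | t ≤ 2 * Real.arctan (1 / (2 * τ k))} : Set ℕ).ncard : ℝ) -
      (Ioo (0:ℝ) π).indicator (fun t => 2 * (1 / t) * (2 * R₂ * (Real.log (1 / t) - 1) + R₁)) t| ≤
      K + C * t ^ (-a) := by
    rw [Set.indicator_of_mem ht]; exact hbt
  have hsq : ((({k : ℕ | t ≤ 2 * Real.arctan (1 / (2 * τ k))} : Set ℕ).ncard : ℝ) -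
      (Ioo (0:ℝ) π).indicator (fun t => 2 * (1 / t) * (2 * R₂ * (Real.log (1 / t) - 1) + R₁)) t) ^ 2 ≤
      (K + C * t ^ (-a)) ^ 2 := by
    rw [← sq_abs]
    exact pow_le_pow_left₀ (abs_nonneg _) habs 2
  have hpow : (t ^ (-a)) ^ 2 = t ^ (-(2 * a)) := by
    rw [← Real.rpow_natCast, ← Real.rpow_mul ht0.le]; congr 1; push_cast; ring
  calc _ ≤ (K + C * t ^ (-a)) ^ 2 := hsq
    _ ≤ 2 * K ^ 2 + 2 * (C * t ^ (-a)) ^ 2 := by nlinarith [sq_nonneg (K - C * t ^ (-a))]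
    _ = 2 * K ^ 2 + 2 * C ^ 2 * t ^ (-(2 * a)) := by rw [mul_pow, hpow]; ring

/-- **Arias de Reyna 2011, Theorem 3.1, in the `(NT)` vocabulary of `Voros2006_NT_REs`** (RH-FREE real
analysis): for a positive non-decreasing sequence `τ_k → ∞` whose counting function satisfies
`#{k : τ_k ≤ T} = 2T[2R₂(log T − 1) + R₁] + O(T^α)` with `α < 1/2`, the Keiper-normalised remainder
`λ̃_n/n − 2π[2R₂(log n − 1 + γ) + R₁]` (`λ̃_n = Σ_k 2(1 − Re(1 − 1/(½ + iτ_k))ⁿ)`) is SQUARE-SUMMABLE.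
The printed hypothesis `S(t) = O(log t)` is the case `R₂ = 1/(8π)`, `R₁ = −log(2π)/(4π)` (any `α ∈ (0, ½)`),
see `AriasDeReyna2011_thm31`.  Proof = the printed one (module docstring): exact identity
`keiperSum_sub_main_eq`, the rates `|Si(x) − π/2| ≤ 2/x`, `|L(A) + πγ/2| ≤ 2(1 + log A)/A`, and Bessel's
inequality for the error `E ∈ L²(0, π)`. [cite: AriasDeReyna2011KeiperLi, Theorem 3.1 pp.9–11] -/
theorem sq_summable_keiperSum_div_sub_main {τ : ℕ → ℝ} {R₂ R₁ α : ℝ} (hτ : ∀ k, 0 < τ k)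
    (hmono : Monotone τ) (hlim : Tendsto τ atTop atTop) (hα : α < 1 / 2)
    (hNT : (fun T : ℝ ↦ (Nat.card {k : ℕ | τ k ≤ T} : ℝ) - 2 * T * (2 * R₂ * (Real.log T - 1) + R₁))
      =O[atTop] (fun T : ℝ ↦ T ^ α)) :
    Summable (fun n : ℕ ↦ ((∑' k : ℕ, 2 * (1 - ((1 - 1 / ((1 / 2 : ℂ) + τ k * Complex.I)) ^ n).re)) / n -
      2 * Real.pi * (2 * R₂ * (Real.log n - 1 + Real.eulerMascheroniConstant) + R₁)) ^ 2) := by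
  have hα1 : α < 1 := by linarith
  -- the error and its sine coefficients
  set E : ℝ → ℝ := fun t ↦ (({k : ℕ | t ≤ 2 * Real.arctan (1 / (2 * τ k))} : Set ℕ).ncard : ℝ) -
        (Ioo (0:ℝ) π).indicator (fun t => 2 * (1 / t) * (2 * R₂ * (Real.log (1 / t) - 1) + R₁)) t
    with hEdef
  set e : ℕ → ℝ := fun n => ∫ t in Ioi (0:ℝ), E t * Real.sin (n * t) with he
  -- the four pieces
  set A : ℕ → ℝ := fun n ↦ 4 * R₂ * (Real.log n * (sinIntegral (n * π) - π / 2)) with hA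
  set B : ℕ → ℝ := fun n ↦ -(4 * R₂ * ((∫ s in (0:ℝ)..((n : ℝ) * π), Real.log s * (Real.sin s / s)) +
      π / 2 * Real.eulerMascheroniConstant)) with hB
  set D : ℕ → ℝ := fun n ↦ (2 * R₁ - 4 * R₂) * (sinIntegral (n * π) - π / 2) with hD
  -- (i) `A`, `B`, `D` are square-summable by the rates
  have hπ3 : 3 < π := Real.pi_gt_three
  have h2nπ : ∀ n : ℕ, 1 ≤ n → 2 / ((n : ℝ) * π) ≤ (1 + Real.log n) / n := by
    intro n hn
    have hn0 : (0:ℝ) < n := by exact_mod_cast hn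
    have hl0 : 0 ≤ Real.log n := Real.log_nonneg (by exact_mod_cast hn)
    calc 2 / ((n : ℝ) * π) ≤ 1 / n := by
          rw [div_le_div_iff₀ (by positivity) hn0]; nlinarith
      _ ≤ (1 + Real.log n) / n := div_le_div_of_nonneg_right (by linarith) hn0.le
  have hsA : Summable (fun n ↦ A n ^ 2) := by
    refine summable_sq_of_abs_le (c := 4 * |R₂|) (n₀ := 1) fun n hn ↦ ?_
    have hn0 : (0:ℝ) < n := by exact_mod_cast hn
    have hl0 : 0 ≤ Real.log n := Real.log_nonneg (by exact_mod_cast hn)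
    have hSi := abs_sinIntegral_sub_pi_div_two_le (x := n * π) (by positivity)
    rw [hA]; dsimp only
    rw [abs_mul, abs_mul, abs_mul, abs_of_nonneg hl0, show |(4:ℝ)| = 4 by norm_num]
    have h1 : Real.log n * |sinIntegral (n * π) - π / 2| ≤ Real.log n * (2 / (n * π)) :=
      mul_le_mul_of_nonneg_left hSi hl0
    have h2 : Real.log n * (2 / (n * π)) ≤ (1 + Real.log n) / n := by
      have h21 : 2 / ((n : ℝ) * π) ≤ 1 / n := by
        rw [div_le_div_iff₀ (by positivity) hn0]; nlinarith
      calc Real.log n * (2 / (n * π)) ≤ Real.log n * (1 / n) := mul_le_mul_of_nonneg_left h21 hl0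
        _ ≤ (1 + Real.log n) / n := by
            rw [mul_one_div]; exact div_le_div_of_nonneg_right (by linarith) hn0.le
    calc 4 * |R₂| * (Real.log n * |sinIntegral (n * π) - π / 2|) ≤ 4 * |R₂| * ((1 + Real.log n) / n) :=
          mul_le_mul_of_nonneg_left (h1.trans h2) (by positivity)
      _ = 4 * |R₂| * ((1 + Real.log n) / n) := rfl
  have hsB : Summable (fun n ↦ B n ^ 2) := by
    refine summable_sq_of_abs_le (c := 4 * |R₂| * 4) (n₀ := 1) fun n hn ↦ ?_
    have hn0 : (0:ℝ) < n := by exact_mod_cast hn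
    have hn1 : (1:ℝ) ≤ n := by exact_mod_cast hn
    have hl0 : 0 ≤ Real.log n := Real.log_nonneg hn1
    have hnπ : (1:ℝ) ≤ n * π := by nlinarith
    have hL := abs_logSineIntegral_add_le hnπ
    rw [hB]; dsimp only
    rw [abs_neg, abs_mul, abs_mul, show |(4:ℝ)| = 4 by norm_num]
    have hlogπ : Real.log π ≤ 2 := by
      have h4 : Real.log π ≤ Real.log 4 := Real.log_le_log Real.pi_pos Real.pi_lt_four.le
      have h4' : Real.log 4 = 2 * Real.log 2 := by
        rw [show (4:ℝ) = 2 ^ 2 by norm_num, Real.log_pow]; norm_num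
      linarith [Real.log_two_lt_d9]
    have hlognπ : Real.log (n * π) = Real.log n + Real.log π := Real.log_mul hn0.ne' Real.pi_pos.ne'
    have h2 : (2 + 2 * Real.log (n * π)) / (n * π) ≤ 4 * ((1 + Real.log n) / n) := by
      rw [hlognπ, div_le_iff₀ (by positivity)]
      have : 4 * ((1 + Real.log n) / n) * (n * π) = 4 * π * (1 + Real.log n) := by
        field_simp
      rw [this]
      nlinarith
    calc 4 * |R₂| * |(∫ s in (0:ℝ)..((n : ℝ) * π), Real.log s * (Real.sin s / s)) +
          π / 2 * Real.eulerMascheroniConstant|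
        ≤ 4 * |R₂| * (4 * ((1 + Real.log n) / n)) :=
          mul_le_mul_of_nonneg_left (hL.trans h2) (by positivity)
      _ = 4 * |R₂| * 4 * ((1 + Real.log n) / n) := by ring
  have hsD : Summable (fun n ↦ D n ^ 2) := by
    refine summable_sq_of_abs_le (c := |2 * R₁ - 4 * R₂|) (n₀ := 1) fun n hn ↦ ?_
    have hn0 : (0:ℝ) < n := by exact_mod_cast hn
    have hl0 : 0 ≤ Real.log n := Real.log_nonneg (by exact_mod_cast hn)
    have hSi := abs_sinIntegral_sub_pi_div_two_le (x := n * π) (by positivity)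
    rw [hD]; dsimp only
    rw [abs_mul]
    exact mul_le_mul_of_nonneg_left (hSi.trans (h2nπ n hn)) (abs_nonneg _)
  -- (ii) `e` is square-summable by Bessel
  have hse : Summable (fun n ↦ e n ^ 2) := by
    obtain ⟨hI1, hI2⟩ := intervalIntegrable_error_sq hτ hmono hlim hα hNT
    have hb := summable_sq_integral_mul_sin (E := E) hI1 hI2
    rw [← summable_nat_add_iff 1]
    refine hb.congr fun n ↦ ?_
    rw [he]; dsimp only
    rw [integral_error_mul_sin_eq hτ hmono hlim hα1 hNT]
    push_cast
    rfl
  -- (iii) the identity for `n ≥ 1`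
  have hsum4 : Summable (fun n ↦ (2 * (A n + B n + D n + e n)) ^ 2) := by
    have h := summable_sq_add (summable_sq_add (summable_sq_add hsA hsB) hsD) hse
    refine (h.mul_left 4).congr fun n ↦ ?_
    ring
  refine summable_sq_of_eqOn_succ hsum4 fun n hn ↦ ?_
  have hn0 : (n : ℝ) ≠ 0 := by exact_mod_cast (show n ≠ 0 by omega)
  have hid := keiperSum_sub_main_eq hτ hmono hlim hα1 hNT hn
  rw [hA, hB, hD, he]
  dsimp only
  rw [div_sub' hn0, div_eq_iff hn0]
  linear_combination hid


/-- The Riemann–von Mangoldt main term in the `(NT)` shape: for `T > 0`,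
`(T/2π) log(T/2π) − T/2π = 2T[2R₂(log T − 1) + R₁]` with `R₂ = 1/(8π)`, `R₁ = −log(2π)/(4π)` ([Voros2006] eq. (EX)).
[cite: AriasDeReyna2011KeiperLi, Thm 3.1 p.9 (hypothesis); Voros2006, §3 eq. (EX) p.5] -/
theorem rvm_main_eq {T : ℝ} (hT : 0 < T) :
    T / (2 * π) * Real.log (T / (2 * π)) - T / (2 * π) =
      2 * T * (2 * (1 / (8 * π)) * (Real.log T - 1) + -Real.log (2 * π) / (4 * π)) := by
  rw [Real.log_div hT.ne' (by positivity)]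
  field_simp
  ring

/-- The printed constant: `2π[2R₂(log m − 1 + γ) + R₁] = ½ log m − ½(log 2π + 1 − γ)` at
`R₂ = 1/(8π)`, `R₁ = −log(2π)/(4π)`. [cite: AriasDeReyna2011KeiperLi, Thm 3.1 p.9] -/
theorem main_const_eq (x : ℝ) :
    2 * Real.pi * (2 * (1 / (8 * π)) * (x - 1 + Real.eulerMascheroniConstant) + -Real.log (2 * π) / (4 * π)) =
      x / 2 - (Real.log (2 * Real.pi) + 1 - Real.eulerMascheroniConstant) / 2 := by
  have hπ : π ≠ 0 := Real.pi_pos.ne'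
  field_simp
  ring

/-- `4 sin²(m θ) = 2(1 − Re(1 − 1/(½ + iτ))^m)` for `θ = arctan(1/2τ)`, `τ > 0` (p.9: «`ρ/(ρ−1) = e^{−2iθ}`,
hence `λ_m = (4/m) Σ sin²(mθ)`»). [cite: AriasDeReyna2011KeiperLi, §3 p.9] -/
theorem four_mul_sin_sq_eq {τ : ℝ} (hτ : 0 < τ) (m : ℕ) :
    4 * Real.sin (m * Real.arctan (1 / (2 * τ))) ^ 2 =
      2 * (1 - ((1 - 1 / ((1 / 2 : ℂ) + τ * Complex.I)) ^ m).re) := by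
  rw [summand_eq hτ m, Real.sin_sq_eq_half_sub]
  ring_nf

end AriasDeReyna2011Thm31

open AriasDeReyna2011Thm31 Voros2006Oesterle in
/-- **[AriasDeReyna2011KeiperLi] Theorem 3.1 p.9, as printed (RH-FREE real analysis), PROVED**: «Let `(γ_j)`
be a non-decreasing sequence of positive real numbers, distributed such that `N(t) = #{j : γ_j ≤ t} =
(t/2π) log(t/2π) − t/2π + S(t)` where `S(t) = O(log t)`.  Defining `θ_j = arctan(1/(2γ_j))`, we then have
`(4/m) Σ_j sin²(m θ_j) = (log m)/2 − (log(2π) + 1 − γ)/2 + y_m` where `(y_m) ∈ ℓ²`.»  Typed with the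
remainder hypothesis in the (weaker, hence more general) form `S(t) = O(t^α)` for some `α < 1/2`
(`O(log t) ⊂ O(t^α)` for every `α > 0`), and with `γ_j → ∞` explicit (it follows from the finiteness of
`N(t)`; kept as a binder to match the tree's `(NT)` typing of `Voros2006_NT_REs`).  This closes the
`TODO(general form)` of `AriasDeReyna2011_cor31`'s docstring without a new definition.
[cite: AriasDeReyna2011KeiperLi, Theorem 3.1 pp.9–11] -/
theorem AriasDeReyna2011_thm31 (γ_ : ℕ → ℝ) (hpos : ∀ j, 0 < γ_ j) (hmono : Monotone γ_)
    (hlim : Tendsto γ_ atTop atTop) {α : ℝ} (hα : α < 1 / 2)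
    (hS : (fun t : ℝ ↦ (Nat.card {j : ℕ | γ_ j ≤ t} : ℝ) -
        (t / (2 * π) * Real.log (t / (2 * π)) - t / (2 * π))) =O[atTop] (fun t : ℝ ↦ t ^ α)) :
    ∃ y : ℕ → ℝ, Summable (fun m ↦ y m ^ 2) ∧ ∀ m : ℕ, 1 ≤ m →
      4 / m * ∑' j, Real.sin (m * Real.arctan (1 / (2 * γ_ j))) ^ 2 =
        Real.log m / 2 - (Real.log (2 * Real.pi) + 1 - Real.eulerMascheroniConstant) / 2 + y m := by
  -- the hypothesis in `(NT)` form
  have hNT : (fun T : ℝ ↦ (Nat.card {k : ℕ | γ_ k ≤ T} : ℝ) -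
      2 * T * (2 * (1 / (8 * π)) * (Real.log T - 1) + -Real.log (2 * π) / (4 * π)))
      =O[atTop] (fun T : ℝ ↦ T ^ α) := by
    refine hS.congr' ?_ EventuallyEq.rfl
    filter_upwards [eventually_gt_atTop 0] with T hT
    rw [rvm_main_eq hT]
  have hmain := sq_summable_keiperSum_div_sub_main hpos hmono hlim hα hNT
  refine ⟨fun m ↦ 4 / m * ∑' j, Real.sin (m * Real.arctan (1 / (2 * γ_ j))) ^ 2 -
    (Real.log m / 2 - (Real.log (2 * Real.pi) + 1 - Real.eulerMascheroniConstant) / 2), ?_,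
    fun m _ ↦ by ring⟩
  refine summable_sq_of_eqOn_succ hmain fun m hm ↦ ?_
  have hm0 : (m : ℝ) ≠ 0 := by exact_mod_cast (show m ≠ 0 by omega)
  have e1 : 4 / (m : ℝ) * ∑' j, Real.sin (m * Real.arctan (1 / (2 * γ_ j))) ^ 2 =
      (∑' j, 2 * (1 - ((1 - 1 / ((1 / 2 : ℂ) + γ_ j * Complex.I)) ^ m).re)) / m := by
    rw [div_mul_eq_mul_div, ← tsum_mul_left]
    congr 1
    exact tsum_congr fun j ↦ four_mul_sin_sq_eq (hpos j) m
  rw [e1, main_const_eq]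


open AriasDeReyna2011Thm31 in
/-- **[AriasDeReyna2011KeiperLi] Theorem 3.1 p.9 with the printed remainder hypothesis `S(t) = O(log t)`
verbatim** (RH-FREE): the case `α = 1/4` of `AriasDeReyna2011_thm31`, since `log t = O(t^{1/4})`.
[cite: AriasDeReyna2011KeiperLi, Theorem 3.1 pp.9–11] -/
theorem AriasDeReyna2011_thm31_of_isBigO_log (γ_ : ℕ → ℝ) (hpos : ∀ j, 0 < γ_ j) (hmono : Monotone γ_)
    (hlim : Tendsto γ_ atTop atTop)
    (hS : (fun t : ℝ ↦ (Nat.card {j : ℕ | γ_ j ≤ t} : ℝ) -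
        (t / (2 * π) * Real.log (t / (2 * π)) - t / (2 * π))) =O[atTop] (fun t : ℝ ↦ Real.log t)) :
    ∃ y : ℕ → ℝ, Summable (fun m ↦ y m ^ 2) ∧ ∀ m : ℕ, 1 ≤ m →
      4 / m * ∑' j, Real.sin (m * Real.arctan (1 / (2 * γ_ j))) ^ 2 =
        Real.log m / 2 - (Real.log (2 * Real.pi) + 1 - Real.eulerMascheroniConstant) / 2 + y m :=
  AriasDeReyna2011_thm31 γ_ hpos hmono hlim (by norm_num : (1 / 4 : ℝ) < 1 / 2)
    (hS.trans (isLittleO_log_rpow_atTop (by norm_num : (0:ℝ) < 1 / 4)).isBigO)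

namespace AriasDeReyna2011Thm31

open Literature.NumberTheory.ConnesConsani2021 Voros2006Oesterle

/-! ## S6. The `ζ` instance under RH -/

/-- The Riemann–von Mangoldt formula in the shape `(NT)` with exponent `1/4` (gm-t14's `NT_zetaOrdinate`
has `1/2`; any positive exponent works since the printed remainder is `O(log T)`, `riemann_von_mangoldt_holds`).
[cite: AriasDeReyna2011KeiperLi, Cor 3.1 p.11 («see Titchmarsh, Theorem 9.4»)] -/
theorem NT_zetaOrdinate_quarter :
    (fun T : ℝ ↦ (Nat.card {k : ℕ | zetaOrdinate k ≤ T} : ℝ) -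
        2 * T * (2 * (1 / (8 * π)) * (Real.log T - 1) + -Real.log (2 * π) / (4 * π)))
      =O[atTop] (fun T : ℝ ↦ T ^ (1 / 4 : ℝ)) := by
  have h1 := riemann_von_mangoldt_holds
  rw [riemann_von_mangoldt] at h1
  have h2 : (fun T : ℝ ↦ (zetaZeroCount T : ℝ) - (T / (2 * π) * Real.log (T / (2 * π)) - T / (2 * π)))
      =O[atTop] (fun T : ℝ ↦ T ^ (1 / 4 : ℝ)) :=
    h1.trans (isLittleO_log_rpow_atTop (by norm_num)).isBigO
  refine h2.congr' ?_ EventuallyEq.rfl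
  filter_upwards [eventually_gt_atTop 0] with T hT
  rw [Nat.card_coe_set_eq, ← zetaZeroCount_eq_ncard_holds T, rvm_main_eq hT]

/-- Under RH, Li's `λ_n` is the Oesterlé sum over the positive ordinates: `λ_n = Σ_k 2(1 − Re(1 −
1/(½ + iγ_k))ⁿ)`, `γ_k = zetaOrdinate k` (with multiplicity) — p.9 «`λ_m = (2/m) Σ_{γ>0} Re(1 − e^{−2imθ})`»
in Li's normalisation; the dictionary block of gm-t14's `thm_onlyif_of_logSineIntegral`, exported
(`keiperLiCoeff_eq_tsum_zeros` + `tsum_nontrivialZeros_eq_tsum_zetaOrdinate`).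
[cite: AriasDeReyna2011KeiperLi, §3 p.9] -/
theorem keiperLiCoeff_eq_tsum_zetaOrdinate (hRH : RiemannHypothesis) {n : ℕ} (hn : 1 ≤ n) :
    keiperLiCoeff n = ∑' k : ℕ, 2 * (1 - ((1 - 1 / ((1 / 2 : ℂ) + (zetaOrdinate k : ℂ) * Complex.I)) ^ n).re) := by
  -- the complex-valued summand as a function of the ordinate
  set g : ℝ → ℂ := fun y ↦ ((((1 : ℂ) - (1 - 1 / ((1 / 2 : ℂ) + (y : ℂ) * Complex.I)) ^ n).re : ℝ) : ℂ)
    with hg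
  have hA : Summable fun ρ : ZetaZeros.riemannZetaNontrivialZeros ↦
      (riemannZetaZeroOrder (ρ : ℂ) : ℂ) * g (ρ : ℂ).im := by
    have h := (Complex.summable_ofReal.2 (summable_keiperLiTerm n))
    refine h.congr fun ρ ↦ ?_
    rw [hg]
    dsimp only
    rw [← coe_eq_half_add_im hRH ρ]
    push_cast
    ring
  have hsum := summable_summand zetaOrdinate_pos_holds zetaOrdinate_mono_holds tendsto_zetaOrdinate_atTop
    (by norm_num : (1 / 2 : ℝ) < 1) NT_zetaOrdinate n
  have hsum' : Summable fun k : ℕ ↦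
      2 * (1 - ((1 - 1 / ((1 / 2 : ℂ) + (zetaOrdinate k : ℂ) * Complex.I)) ^ n).re) :=
    hsum.congr fun k ↦ (summand_eq (zetaOrdinate_pos_holds k) n).symm
  have hgg : ∀ k : ℕ, g (zetaOrdinate k) + g (-zetaOrdinate k) =
      ((2 * (1 - ((1 - 1 / ((1 / 2 : ℂ) + (zetaOrdinate k : ℂ) * Complex.I)) ^ n).re) : ℝ) : ℂ) := by
    intro k
    rw [hg]
    dsimp only
    rw [show (((-zetaOrdinate k : ℝ)) : ℂ) = (((-zetaOrdinate k : ℝ)) : ℂ) from rfl, re_summand_neg,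
      Complex.sub_re, Complex.one_re]
    push_cast
    ring
  have hB : Summable fun k : ℕ ↦ g (zetaOrdinate k) + g (-zetaOrdinate k) := by
    have h := Complex.summable_ofReal.2 hsum'
    exact h.congr fun k ↦ (hgg k).symm
  have hdict := tsum_nontrivialZeros_eq_tsum_zetaOrdinate g hA hB
  apply Complex.ofReal_injective
  rw [keiperLiCoeff_eq_tsum_zeros hn, Complex.ofReal_tsum, Complex.ofReal_tsum]
  have e1 : ∀ ρ : ZetaZeros.riemannZetaNontrivialZeros,
      (((riemannZetaZeroOrder (ρ : ℂ) : ℝ) * (1 - (1 - 1 / (ρ : ℂ)) ^ n).re : ℝ) : ℂ) =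
        (riemannZetaZeroOrder (ρ : ℂ) : ℂ) * g (ρ : ℂ).im := by
    intro ρ
    rw [hg]
    dsimp only
    rw [← coe_eq_half_add_im hRH ρ]
    push_cast
    ring
  rw [tsum_congr e1, hdict, tsum_congr hgg]

end AriasDeReyna2011Thm31

open AriasDeReyna2011Thm31 Voros2006Oesterle in
/-- **DISCHARGE of `AriasDeReyna2011_cor31`** — [AriasDeReyna2011KeiperLi] Corollary 3.1 p.11, PROVED:
«By assuming the Riemann Hypothesis we have `λ_m = (log m)/2 − (log(2π) + 1 − γ)/2 + y_m` where
`(y_m) ∈ ℓ²`» (Keiper's `λ_m = keiperLambdaK m`).  Proof as printed: «the ordinates of the zeros `γ_n`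
satisfy the hypothesis of Theorem 3.1 (Titchmarsh Thm 9.4)» — `sq_summable_keiperSum_div_sub_main` at
`τ = zetaOrdinate`, `R₂ = 1/(8π)`, `R₁ = −log(2π)/(4π)`, exponent `1/4` (`NT_zetaOrdinate_quarter`), with
`λ_n = Σ_k 2(1 − Re(1 − 1/(½ + iγ_k))ⁿ)` under RH (`keiperLiCoeff_eq_tsum_zetaOrdinate`).  LABEL:
RH-CONSEQUENCE with the explicit binder `RiemannHypothesis →`; nothing here bears on the truth of RH.
[cite: AriasDeReyna2011KeiperLi, Corollary 3.1 p.11] -/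
theorem AriasDeReyna2011_cor31_holds : AriasDeReyna2011_cor31 := by
  intro hRH
  have hmain := sq_summable_keiperSum_div_sub_main zetaOrdinate_pos_holds zetaOrdinate_mono_holds
    tendsto_zetaOrdinate_atTop (by norm_num : (1 / 4 : ℝ) < 1 / 2) NT_zetaOrdinate_quarter
  refine ⟨fun m ↦ keiperLambdaK m -
    (Real.log m / 2 - (Real.log (2 * Real.pi) + 1 - Real.eulerMascheroniConstant) / 2), ?_,
    fun m _ ↦ by ring⟩
  refine summable_sq_of_eqOn_succ hmain fun m hm ↦ ?_
  rw [keiperLambdaK, keiperLiCoeff_eq_tsum_zetaOrdinate hRH hm, main_const_eq]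

/-- **[AriasDeReyna2011KeiperLi], main theorem (abstract; §1 p.8), now hypothesis-free** — «the Riemann
Hypothesis is equivalent to the assertion `(y_m) ∈ ℓ²` where `λ_m = ½(log m + γ − log(2π) − 1) + y_m`»:
t13's `AriasDeReyna2011_thm_main_of_cor31` fed with `AriasDeReyna2011_cor31_holds`.  LABEL (l.1):
RH-EQUIVALENT·PRINTED, PROVED AS AN EQUIVALENCE — neither side is asserted; nothing here bears on the
truth of RH. [cite: AriasDeReyna2011KeiperLi, abstract and §1 p.8] -/
theorem AriasDeReyna2011_thm_main_holds :
    RiemannHypothesis ↔ Summable (fun m : ℕ ↦ (keiperLambdaK m -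
      (Real.log m / 2 - (Real.log (2 * Real.pi) + 1 - Real.eulerMascheroniConstant) / 2)) ^ 2) :=
  AriasDeReyna2011_thm_main_of_cor31 AriasDeReyna2011_cor31_holds

/-- **[AriasDeReyna2011KeiperLi] Theorem 4.3 p.15, now hypothesis-free** — «The Riemann Hypothesis is
equivalent to the assertion that the sequence `(A_n)` is in `ℓ²`» (`A_n = ariasA n`): t13's
`AriasDeReyna2011_thm43_of_cor31` fed with `AriasDeReyna2011_cor31_holds`.  LABEL (l.1):
RH-EQUIVALENT·PRINTED, PROVED AS AN EQUIVALENCE — neither side is asserted; nothing here bears on the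
truth of RH. [cite: AriasDeReyna2011KeiperLi, Theorem 4.3 p.15] -/
theorem AriasDeReyna2011_thm43_holds : RiemannHypothesis ↔ Summable (fun n ↦ ariasA n ^ 2) :=
  AriasDeReyna2011_thm43_of_cor31 AriasDeReyna2011_cor31_holds

end Literature.NumberTheory.LFunctions

end
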